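import Literature.MathematicalPhysics.QuantumFieldTheory.Balaban1983to89.B6Eq28LandauGaugeV1
import Literature.MathematicalPhysics.QuantumFieldTheory.Balaban1983to89.B5Positivity172Lattice
import HarnessLib

/-!
# Route `UnitScaleTilt`, crux K1 «MinimiserStabilityRegPr» (stmt-QuantumFields-19200), line «route-R» (`Lines/birth_routeR.lean` v2 5b75208179c6919a),
# stub P `stub_relPoincareOpt` — linear flat core, step N1–N3 of the P-lin-flat plan (CARD-19200-V3-g11): THE HODGE SPLIT OF A BOND FIELD ON THE
# TORUS AND THE DIRICHLET PRINCIPLE FOR THE PINNED SLICE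

Cell `ym3-torus` ∕ fleet seat `ym-ust-19200-p1` (gen 11, route-R lead).  WHY.  Route-R's hardest stub P asks for the `ℓ²` coercivity of the PINNED
`ℓ²`-optimal slice (Euler–Lagrange: divergence of the representative vanishes OFF the k-centres, point charges AT the centres) with the true
(0.4)-constraint.  Its linear flat core (P-lin-flat: `Σ_b A(b)² ≤ C·L^{2(K−n)}·Σ_p (∂A)(p)²` for `Q^{(k)}A = 0`, `∂^*A` supported on the centres,
`C` independent of `K − n` and of the volume; kit j296798∕j296873∕j297007: the slice gap equals the free transverse gap `4 sin²(π/2L^{K−n})`,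
zone-boundary mode, no centre charge) is NOT reached through the charges (they are not bounded by the curl uniformly) but through the HODGE SPLIT
`A = B + ∂φ`, `∂^*B = 0`: then `‖A‖² = ‖B‖² + ‖∂φ‖²`, `∂B = ∂A`, `B` is handled by the tree's flat engine
(`Prop7FlatCoercivity.sum_sq_le_lineBlockAvg_add_curl_add_diverg`, p452018) and `φ` — harmonic off the centres — by the Dirichlet principle
(`‖∂φ‖² ≤ ‖∂ψ‖²` for every `ψ` agreeing with `φ` where `Δφ ≠ 0`) against an interpolant of its centre values.  This file supplies exactly these three
elementary facts on the `Setup` torus `T^{(j)}` in the letters of `LatticeFieldCalculus` (lattice factor `c ≠ 0` throughout).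

WHAT IS PROVED (sorry-free, no definition; [folklore] lattice calculus):
* §1 `sum_diverg_eq_zero`, `sum_laplace_eq_zero` (a divergence sums to zero over the torus), `sum_mul_laplace_comm` (`Δ` is symmetric).
* §2 **`exists_coulombGauge`**: every real bond field has a gauge transform `A − ∂λ` with VANISHING DIVERGENCE (the full Landau∕Coulomb gauge on the
  torus; the tree's `B6Eq28LandauGaugeV1.exists_landauGauge` is the BLOCK-restricted one, `Q′λ = 0`, gauge condition `R∂^* = 0`) — by orthogonal
  projection of `∂^*A` onto `ΔL²(T)` (`Submodule.starProjection`, the pattern of `exists_landauGauge`) and `ker Δ = constants`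
  (`B5Positivity172Lattice.const_of_laplace_eq_zero`).
* §3 **`exists_hodgeSplit`**: `∃ λ, ∂^*(A − ∂λ) = 0 ∧ Σ_b A(b)² = Σ_b (A − ∂λ)(b)² + Σ_b (∂λ)(b)² ∧ ∂(A − ∂λ) = ∂A` (energy orthogonality by
  `sum_grad_mul`; the curl is gauge invariant, `curl_gaugeShift`).
* §4 **`sum_grad_sq_le_of_eq_on_support`** (Dirichlet principle): if `ψ = φ` wherever `Δφ ≠ 0`, then `Σ_b (∂φ)(b)² ≤ Σ_b (∂ψ)(b)²`;
  `laplace_hodge_eq_diverg`: the Hodge potential of `A` has `Δλ = ∂^*A`, so for a field of the PINNED SLICE (divergence supported on a set `C`)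
  every interpolant of `λ|_C` bounds `‖∂λ‖²` (`sum_grad_sq_hodge_le`).

HONEST SCOPE.  Linear, flat, abelian (one real component of `𝔰𝔲(2)`); nothing of Bałaban's analysis is asserted; the remaining steps of the plan
(face-flux split N5, the structure theorem with the `(H¹)^*`-bound N6, interpolation N4, assembly N7) are separate files.

References: T. Bałaban, CMP 95 (1984) 17–40 [Balaban1984PropagatorsI] ((1.21) p.21, p.22); CMP 96 (1984) 223–250 [Balaban1984PropagatorsII]
((2.8)–(2.12) pp.224–225); CMP 102 (1985) 277–309 [Balaban1985Variational] (Prop. 7 p.299, (141)–(143)).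
-/

noncomputable section

open scoped BigOperators

namespace Summit.QuantumFields.YangMills.Theorems.Prop7PinnedHodgeSplit

open Literature.MathematicalPhysics.QuantumFieldTheory.Balaban1983to89
open Finset LatticeFieldCalculus
open B6Eq28LandauGaugeV1 (laplace_add laplace_smul laplace_sub laplace_zero diverg_gaugeShift_apply)
open B5Positivity172Lattice (const_of_laplace_eq_zero)

variable {P : Params} {j : ℕ}

/-! ## §1 Sums over the torus -/

/-- **A divergence sums to zero over the torus**: `Σ_x (∂^*A)(x) = 0` (summation by parts against the constant `1`, whose gradient vanishes).
[cite: Balaban1984PropagatorsI, (1.21) p.21] -/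
theorem sum_diverg_eq_zero (c : ℝ) (A : VecField P j ℝ) : ∑ x : Site P j, diverg c A x = 0 := by
  have h := sum_grad_mul c (fun _ : Site P j => (1 : ℝ)) A
  have h0 : ∀ b : PBond P j, grad c (fun _ : Site P j => (1 : ℝ)) b = 0 := fun b => by
    simp [grad]
  simp only [h0, zero_mul, Finset.sum_const_zero, one_mul] at h
  exact h.symm

/-- `Σ_x (Δλ)(x) = 0` (`Δ = ∂^*∂`). [cite: Balaban1984PropagatorsI, (1.21) p.21] -/
theorem sum_laplace_eq_zero (c : ℝ) (lam : SiteField P j ℝ) : ∑ x : Site P j, laplace c lam x = 0 := by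
  rw [← diverg_grad]
  exact sum_diverg_eq_zero c (grad c lam)

/-- `Σ_x f(x)(Δg)(x) = Σ_b (∂f)(b)(∂g)(b)`. [cite: Balaban1984PropagatorsI, (1.21) p.21] -/
theorem sum_mul_laplace_eq_sum_grad_mul (c : ℝ) (f g : SiteField P j ℝ) :
    ∑ x : Site P j, f x * laplace c g x = ∑ b : PBond P j, grad c f b * grad c g b := by
  rw [← diverg_grad]
  exact (sum_grad_mul c f (grad c g)).symm

/-- **`Δ` is symmetric**: `Σ_x f(x)(Δg)(x) = Σ_x (Δf)(x) g(x)`. [cite: Balaban1984PropagatorsI, (1.21) p.21] -/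
theorem sum_mul_laplace_comm (c : ℝ) (f g : SiteField P j ℝ) :
    ∑ x : Site P j, f x * laplace c g x = ∑ x : Site P j, laplace c f x * g x := by
  rw [sum_mul_laplace_eq_sum_grad_mul, show (∑ x : Site P j, laplace c f x * g x) = ∑ x : Site P j, g x * laplace c f x from
    Finset.sum_congr rfl fun x _ => mul_comm _ _, sum_mul_laplace_eq_sum_grad_mul]
  exact Finset.sum_congr rfl fun b _ => mul_comm _ _

/-- `Σ_x f(x)(Δf)(x) = Σ_b (∂f)(b)²`. [cite: Balaban1984PropagatorsI, (1.21) p.21] -/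
theorem sum_mul_laplace_self (c : ℝ) (f : SiteField P j ℝ) :
    ∑ x : Site P j, f x * laplace c f x = ∑ b : PBond P j, grad c f b ^ 2 := by
  rw [sum_mul_laplace_eq_sum_grad_mul]
  exact Finset.sum_congr rfl fun b _ => by rw [sq]

/-- A gradient that vanishes identically has a constant potential (`c ≠ 0`; the torus is connected by unit steps). [cite: Balaban1984PropagatorsI, p.22 (text)] -/
theorem const_of_grad_eq_zero {c : ℝ} (hc : c ≠ 0) {lam : SiteField P j ℝ} (h : ∀ b : PBond P j, grad c lam b = 0) (x : Site P j) :
    lam x = lam default := by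
  have hg : grad c lam = 0 := funext h
  have hΔ : laplace c lam = 0 := by
    rw [← diverg_grad, hg]
    funext y
    simp [diverg]
  exact const_of_laplace_eq_zero hc hΔ x

/-! ## §2 The full Landau (Coulomb) gauge on the torus -/

/-- **EVERY BOND FIELD HAS A DIVERGENCE-FREE GAUGE TRANSFORM** (`c ≠ 0`): `∃ λ, ∂^*(A − ∂λ) = 0`.  Proof: project `∂^*A` orthogonally onto the
subspace `ΔL²(T^{(j)})`; the remainder `f = ∂^*A − Δλ₀` is orthogonal to every `Δδ`, in particular `Σ f·Δf = Σ(∂f)² = 0`, so `f` is constant, and a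
constant of zero sum vanishes. [cite: Balaban1984PropagatorsII, (2.10)-(2.12) p.225] -/
theorem exists_coulombGauge {c : ℝ} (hc : c ≠ 0) (A : VecField P j ℝ) :
    ∃ lam : SiteField P j ℝ, diverg c (gaugeShift c lam A) = 0 := by
  classical
  -- the subspace `ΔL²(T^{(j)})`
  let K : Submodule ℝ (EuclideanSpace ℝ (Site P j)) :=
    { carrier := {u | ∃ l : SiteField P j ℝ, WithLp.ofLp u = laplace c l}
      add_mem' := by
        rintro u v ⟨l, hu⟩ ⟨l', hv⟩
        exact ⟨l + l', by rw [WithLp.ofLp_add, hu, hv, laplace_add]⟩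
      zero_mem' := ⟨0, by rw [WithLp.ofLp_zero, laplace_zero]⟩
      smul_mem' := by
        rintro a u ⟨l, hu⟩
        exact ⟨a • l, by rw [WithLp.ofLp_smul, hu, laplace_smul]⟩ }
  let u : EuclideanSpace ℝ (Site P j) := WithLp.toLp 2 (diverg c A)
  obtain ⟨l₀, hpl⟩ : K.starProjection u ∈ K := K.starProjection_apply_mem u
  refine ⟨l₀, ?_⟩
  set f : SiteField P j ℝ := diverg c (gaugeShift c l₀ A) with hf
  have horth := K.sub_starProjection_mem_orthogonal u
  have hsub : u - K.starProjection u = WithLp.toLp 2 f := by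
    apply WithLp.ofLp_injective 2
    rw [WithLp.ofLp_sub, hpl, WithLp.ofLp_toLp, WithLp.ofLp_toLp, hf, diverg_gaugeShift]
    rfl
  -- `f ⊥ Δδ` for every `δ`
  have hperp : ∀ δ : SiteField P j ℝ, ∑ x : Site P j, laplace c δ x * f x = 0 := by
    intro δ
    have hmemδ : WithLp.toLp 2 (laplace c δ) ∈ K := ⟨δ, by rw [WithLp.ofLp_toLp]⟩
    have h := Submodule.inner_right_of_mem_orthogonal hmemδ horth
    rw [hsub] at h
    simpa only [PiLp.inner_apply, RCLike.inner_apply, conj_trivial, PiLp.toLp_apply, mul_comm] using h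
  -- `Σ f Δf = Σ (∂f)² = 0`, so `∂f = 0`, so `f` is constant
  have hsq : ∑ b : PBond P j, grad c f b ^ 2 = 0 := by
    rw [← sum_mul_laplace_self, sum_mul_laplace_comm]
    exact hperp f
  have hgrad : ∀ b : PBond P j, grad c f b = 0 := fun b =>
    pow_eq_zero_iff (n := 2) (by norm_num) |>.mp
      ((Finset.sum_eq_zero_iff_of_nonneg fun b _ => sq_nonneg (grad c f b)).mp hsq b (Finset.mem_univ _))
  have hconst : ∀ x, f x = f default := const_of_grad_eq_zero hc hgrad
  -- a constant divergence has zero sum, hence vanishes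
  have hsum : ∑ x : Site P j, f x = 0 := sum_diverg_eq_zero c _
  have hcard : ∑ x : Site P j, f x = (Fintype.card (Site P j) : ℝ) * f default := by
    rw [Finset.sum_congr rfl fun x _ => hconst x, Finset.sum_const, nsmul_eq_mul, Finset.card_univ]
  have hpos : (0 : ℝ) < Fintype.card (Site P j) := by
    have : 0 < Fintype.card (Site P j) := Fintype.card_pos
    exact_mod_cast this
  have h0 : f default = 0 := by
    rw [hcard] at hsum
    rcases mul_eq_zero.mp hsum with h | h
    · exact absurd h (ne_of_gt hpos)
    · exact h
  funext x
  rw [hconst x, h0]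
  rfl

/-! ## §3 The Hodge split with the energy identity -/

/-- Energy orthogonality: a divergence-free field is `ℓ²`-orthogonal to every gradient. [cite: Balaban1984PropagatorsI, (1.21) p.21] -/
theorem sum_grad_mul_eq_zero_of_diverg_eq_zero (c : ℝ) (lam : SiteField P j ℝ) {B : VecField P j ℝ} (hB : diverg c B = 0) :
    ∑ b : PBond P j, grad c lam b * B b = 0 := by
  rw [sum_grad_mul, hB]
  simp

/-- **THE HODGE SPLIT WITH THE ENERGY IDENTITY** (`c ≠ 0`): every real bond field `A` on the torus is `A = B + ∂λ` with `∂^*B = 0`,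
`Σ_b A(b)² = Σ_b B(b)² + Σ_b (∂λ)(b)²`, and the same curl, `∂B = ∂A` (`B = A − ∂λ = gaugeShift c λ A`). [cite: Balaban1984PropagatorsI, (1.21) p.21] -/
theorem exists_hodgeSplit {c : ℝ} (hc : c ≠ 0) (A : VecField P j ℝ) :
    ∃ lam : SiteField P j ℝ, diverg c (gaugeShift c lam A) = 0 ∧
      ∑ b : PBond P j, A b ^ 2 = ∑ b : PBond P j, gaugeShift c lam A b ^ 2 + ∑ b : PBond P j, grad c lam b ^ 2 ∧
      ∀ (c' : ℝ) (p : Plaq P j), curl c' (gaugeShift c lam A) p = curl c' A p := by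
  obtain ⟨lam, hlam⟩ := exists_coulombGauge hc A
  refine ⟨lam, hlam, ?_, fun c' p => curl_gaugeShift c' c lam A p⟩
  have hcross := sum_grad_mul_eq_zero_of_diverg_eq_zero c lam hlam
  have hA : ∀ b : PBond P j, A b = gaugeShift c lam A b + grad c lam b := fun b => by
    simp [gaugeShift]
  calc ∑ b : PBond P j, A b ^ 2 = ∑ b : PBond P j, (gaugeShift c lam A b + grad c lam b) ^ 2 :=
        Finset.sum_congr rfl fun b _ => by rw [← hA b]
    _ = ∑ b : PBond P j, gaugeShift c lam A b ^ 2 + ∑ b : PBond P j, grad c lam b ^ 2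
          + 2 * ∑ b : PBond P j, grad c lam b * gaugeShift c lam A b := by
        rw [Finset.mul_sum, ← Finset.sum_add_distrib, ← Finset.sum_add_distrib]
        exact Finset.sum_congr rfl fun b _ => by ring
    _ = ∑ b : PBond P j, gaugeShift c lam A b ^ 2 + ∑ b : PBond P j, grad c lam b ^ 2 := by
        rw [hcross, mul_zero, add_zero]

/-- The Hodge potential solves the Poisson equation `Δλ = ∂^*A`. [cite: Balaban1984PropagatorsI, (1.21) p.21] -/
theorem laplace_eq_diverg_of_hodge (c : ℝ) {A : VecField P j ℝ} {lam : SiteField P j ℝ} (h : diverg c (gaugeShift c lam A) = 0) :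
    laplace c lam = diverg c A := by
  funext x
  have hx := congrFun h x
  rw [diverg_gaugeShift_apply, Pi.zero_apply] at hx
  linarith

/-! ## §4 The Dirichlet principle (the potential is energy-minimal among functions with the same values where its Laplacian lives) -/

/-- **DIRICHLET PRINCIPLE ON THE TORUS**: if `ψ = φ` at every site where `Δφ ≠ 0`, then `Σ_b (∂φ)(b)² ≤ Σ_b (∂ψ)(b)²` — with `η = ψ − φ`,
`Σ(∂ψ)² = Σ(∂φ)² + Σ(∂η)² + 2Σ η·Δφ` and the cross term vanishes sitewise. [cite: Balaban1984PropagatorsI, (1.21) p.21] -/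
theorem sum_grad_sq_le_of_eq_on_support (c : ℝ) (φ ψ : SiteField P j ℝ) (h : ∀ x : Site P j, laplace c φ x ≠ 0 → ψ x = φ x) :
    ∑ b : PBond P j, grad c φ b ^ 2 ≤ ∑ b : PBond P j, grad c ψ b ^ 2 := by
  set η : SiteField P j ℝ := fun x => ψ x - φ x with hη
  have hψ : ∀ b : PBond P j, grad c ψ b = grad c φ b + grad c η b := fun b => by
    simp only [grad, hη, smul_eq_mul]
    ring
  have hcross : ∑ b : PBond P j, grad c η b * grad c φ b = 0 := by
    rw [← sum_mul_laplace_eq_sum_grad_mul]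
    refine Finset.sum_eq_zero fun x _ => ?_
    by_cases hx : laplace c φ x = 0
    · rw [hx, mul_zero]
    · have : η x = 0 := by rw [hη]; exact sub_eq_zero.mpr (h x hx)
      rw [this, zero_mul]
  have hexp : ∑ b : PBond P j, grad c ψ b ^ 2
      = ∑ b : PBond P j, grad c φ b ^ 2 + ∑ b : PBond P j, grad c η b ^ 2 + 2 * ∑ b : PBond P j, grad c η b * grad c φ b := by
    rw [Finset.mul_sum, ← Finset.sum_add_distrib, ← Finset.sum_add_distrib]
    exact Finset.sum_congr rfl fun b _ => by rw [hψ b]; ring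
  rw [hexp, hcross, mul_zero, add_zero]
  have : 0 ≤ ∑ b : PBond P j, grad c η b ^ 2 := Finset.sum_nonneg fun b _ => sq_nonneg _
  linarith

/-- **THE PINNED SLICE**: if the divergence of `A` is supported on a set `C` of sites (the Euler–Lagrange equation of the `ℓ²`-optimal pinned
representative: lattice Landau gauge OFF the k-centres, gen 6 `Prop7CompactChart.optimalRepr_site_stationary`), then the Hodge potential `λ` of `A`
(`∂^*(A − ∂λ) = 0`) is harmonic off `C`, and every site function agreeing with `λ` on `C` has at least its Dirichlet energy.
[cite: Balaban1985Variational, Prop. 7 p.299, (141)-(143) p.299] -/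
theorem sum_grad_sq_hodge_le (c : ℝ) {A : VecField P j ℝ} {C : Set (Site P j)} (hA : ∀ x : Site P j, x ∉ C → diverg c A x = 0)
    {lam : SiteField P j ℝ} (hlam : diverg c (gaugeShift c lam A) = 0) (ψ : SiteField P j ℝ) (hψ : ∀ x ∈ C, ψ x = lam x) :
    ∑ b : PBond P j, grad c lam b ^ 2 ≤ ∑ b : PBond P j, grad c ψ b ^ 2 := by
  refine sum_grad_sq_le_of_eq_on_support c lam ψ fun x hx => hψ x ?_
  by_contra hxC
  rw [laplace_eq_diverg_of_hodge c hlam] at hx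
  exact hx (hA x hxC)

/-- **SUMMARY FOR THE P-LIN-FLAT ASSEMBLY** (`c ≠ 0`): a bond field whose divergence is supported on `C` splits as `A = B + ∂λ` with `∂^*B = 0`,
`∂B = ∂A`, `Σ A² = Σ B² + Σ(∂λ)²`, `Δλ = ∂^*A`, and `Σ(∂λ)² ≤ Σ(∂ψ)²` for every `ψ` that agrees with `λ` on `C`.
[cite: Balaban1985Variational, Prop. 7 p.299, (141)-(143) p.299] -/
theorem exists_hodgeSplit_pinned {c : ℝ} (hc : c ≠ 0) (A : VecField P j ℝ) {C : Set (Site P j)}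
    (hA : ∀ x : Site P j, x ∉ C → diverg c A x = 0) :
    ∃ lam : SiteField P j ℝ, diverg c (gaugeShift c lam A) = 0 ∧ laplace c lam = diverg c A ∧
      ∑ b : PBond P j, A b ^ 2 = ∑ b : PBond P j, gaugeShift c lam A b ^ 2 + ∑ b : PBond P j, grad c lam b ^ 2 ∧
      (∀ (c' : ℝ) (p : Plaq P j), curl c' (gaugeShift c lam A) p = curl c' A p) ∧
      ∀ ψ : SiteField P j ℝ, (∀ x ∈ C, ψ x = lam x) → ∑ b : PBond P j, grad c lam b ^ 2 ≤ ∑ b : PBond P j, grad c ψ b ^ 2 := by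
  obtain ⟨lam, hdiv, hE, hcurl⟩ := exists_hodgeSplit hc A
  exact ⟨lam, hdiv, laplace_eq_diverg_of_hodge c hdiv, hE, hcurl, fun ψ hψ => sum_grad_sq_hodge_le c hA hdiv ψ hψ⟩

end Summit.QuantumFields.YangMills.Theorems.Prop7PinnedHodgeSplit

end
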